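import Summits.QuantumFields.YangMills.Theorems.BalabanLadderUVSeamRecUnitDilation
import HarnessLib

/-!
# Crux `UVSeamRec` (stmt-QuantumFields-20043), stub `stub_floors`: floors at a comparable unit from SCALE-WINDOW floors

Helper file (`--supports stmt-QuantumFields-20043`) of the lead prover of `stub_floors` (unit `ym-spine-20043-p1`); the
second transport mechanism of the split card «floors by unit transfer» (item evidence `LINE-CARD-stub_floors.md`).

The asymptotic transfer `UnitTransfer.lowerBounds_of_tendsto_div` needs RATIO CONVERGENCE `a/u → c₀` and the CEILINGS at the
target unit.  Both are dispensable if the engine delivers its floors for a WINDOW of scales: the same witnesses `v`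
(resp. `f, g, h`) floor the smeared two- and three-point functions at every smearing scale `a β / s`, `s ∈ [s₁, s₂]`, with
uniform constants.  This is what the femto line's `stub_lower` argument actually yields (its bump scale `s` is any
sufficiently small number and the floor `ε ∝ s⁸`, resp. `s¹²`, is monotone in `s`) — recorded here as the TARGET SHAPE
for the engine; this file proves only the (exact, estimate-free) transfer:

* `lowerBounds_of_window` — window floors at unit `a` over `s ∈ [s₁, s₂]` (`0 < s₁`) and two-sided comparability
  `s₁ ≤ a β / u β ≤ s₂` eventually ⇒ `LowerBounds G r u` (same witnesses, same `ε`): at each `β` read the window floor at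
  the scale `s = a β / u β`, for which `a β / s = u β` exactly;
* `stubFloors_of_windowEngine` — the corresponding reshaped floors stub at the unit of record (`SU(2)`, Borel): ONE
  representation with window floors at an engine unit `a` with `s₁ ≤ a/uRec ≤ s₂` eventually ⇒ the conclusion of the
  registered `stub_floors`; NO ceilings, NO ratio convergence, NO compact support — the price moves entirely into the
  window-uniformity of the engine's floors («two-loop scaling of the engine unit up to BOUNDED factors»).
-/

set_option autoImplicit false

noncomputable section

open scoped SchwartzMap
open MeasureTheory Filter Topology
open Literature.MathematicalPhysics.QuantumFieldTheory Literature.MathematicalPhysics.QuantumLattice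
open Summit.QuantumFields.YangMills.Cruxes.OSLegsFromFemtoAndGap.DlrCollarTransfer

namespace Summit.QuantumFields.YangMills.Cruxes.UVSeamRec.WindowTransfer

variable {G : Type} [Group G] [TopologicalSpace G] [IsTopologicalGroup G] [CompactSpace G]
  [MeasurableSpace G] [BorelSpace G]

/-- Bookkeeping for the window: at a coupling where `s₁ ≤ a/u ≤ s₂` (`0 < s₁`, `0 < u`), the scale `s = a/u` lies in the
window, `a / s = u`, and a volume threshold `Λ / s₁ ≤ u · L` gives `Λ ≤ a · L`. [folklore] -/
theorem window_scale {a u s₁ s₂ Λ : ℝ} {L : ℕ} (hs₁ : 0 < s₁) (hu : 0 < u) (hlo : s₁ ≤ a / u) (hhi : a / u ≤ s₂)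
    (hL : Λ / s₁ ≤ u * L) :
    a / u ∈ Set.Icc s₁ s₂ ∧ a / (a / u) = u ∧ Λ ≤ a * L := by
  have ha : 0 < a := by
    have h := mul_pos hs₁ hu
    rw [le_div_iff₀ hu] at hlo
    linarith
  refine ⟨⟨hlo, hhi⟩, by field_simp, ?_⟩
  rw [div_le_iff₀ hs₁] at hL
  rw [le_div_iff₀ hu] at hlo
  have hL0 : (0 : ℝ) ≤ L := Nat.cast_nonneg L
  calc Λ ≤ u * L * s₁ := hL
    _ = s₁ * u * L := by ring
    _ ≤ a * L := mul_le_mul_of_nonneg_right hlo hL0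

/-- **Floors at a comparable unit from scale-window floors** (exact; no ceilings, no ratio convergence).  If the SAME
witnesses floor `Q2(θv, v)` and `|Q3(f, g, h)|` at every smearing scale `a β / s`, `s ∈ [s₁, s₂]` (`0 < s₁`), uniformly,
and `s₁ ≤ a β / u β ≤ s₂` eventually, then `LowerBounds G r u`. [folklore] -/
theorem lowerBounds_of_window (r : LatticeRep G) {a u : ℝ → ℝ} {s₁ s₂ : ℝ} (hs₁ : 0 < s₁) (hu : ∀ β, 0 < u β)
    (hwin : ∀ᶠ β in atTop, s₁ ≤ a β / u β ∧ a β / u β ≤ s₂)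
    (h2 : ∃ (v : 𝓢(EuclideanSpace ℝ (Fin 4), ℝ)) (ε β₅ Λ₅ : ℝ),
      tsupport (v : EuclideanSpace ℝ (Fin 4) → ℝ) ⊆ {y : EuclideanSpace ℝ (Fin 4) | 0 < y 0} ∧ 0 < ε ∧
      ∀ s ∈ Set.Icc s₁ s₂, ∀ β : ℝ, β₅ ≤ β → ∀ L : ℕ, Λ₅ ≤ a β * L →
        ε ≤ Q2 G r β L (a β / s) (thetaTest 4 v) v)
    (h3 : ∃ (f g h : 𝓢(EuclideanSpace ℝ (Fin 4), ℝ)) (ε β₅ Λ₅ : ℝ),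
      Disjoint (tsupport (f : EuclideanSpace ℝ (Fin 4) → ℝ)) (tsupport (g : EuclideanSpace ℝ (Fin 4) → ℝ)) ∧
      Disjoint (tsupport (g : EuclideanSpace ℝ (Fin 4) → ℝ)) (tsupport (h : EuclideanSpace ℝ (Fin 4) → ℝ)) ∧
      Disjoint (tsupport (f : EuclideanSpace ℝ (Fin 4) → ℝ)) (tsupport (h : EuclideanSpace ℝ (Fin 4) → ℝ)) ∧ 0 < ε ∧
      ∀ s ∈ Set.Icc s₁ s₂, ∀ β : ℝ, β₅ ≤ β → ∀ L : ℕ, Λ₅ ≤ a β * L → ε ≤ |Q3 G r β L (a β / s) f g h|) :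
    LowerBounds G r u := by
  obtain ⟨β₀, hβ₀⟩ := Filter.eventually_atTop.1 hwin
  obtain ⟨v, ε, β₅, Λ₅, hv, hε, H2⟩ := h2
  obtain ⟨f, g, h, ε', β₅', Λ₅', hfg, hgh, hfh, hε', H3⟩ := h3
  refine ⟨⟨v, ε, max β₅ β₀, max Λ₅ 0 / s₁, hv, hε, fun β hβ L hL => ?_⟩,
    ⟨f, g, h, ε', max β₅' β₀, max Λ₅' 0 / s₁, hfg, hgh, hfh, hε', fun β hβ L hL => ?_⟩⟩
  · obtain ⟨hwlo, hwhi⟩ := hβ₀ β ((le_max_right _ _).trans hβ)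
    obtain ⟨hmem, heq, hΛ⟩ := window_scale hs₁ (hu β) hwlo hwhi hL
    have := H2 (a β / u β) hmem β ((le_max_left _ _).trans hβ) L ((le_max_left _ _).trans hΛ)
    rwa [heq] at this
  · obtain ⟨hwlo, hwhi⟩ := hβ₀ β ((le_max_right _ _).trans hβ)
    obtain ⟨hmem, heq, hΛ⟩ := window_scale hs₁ (hu β) hwlo hwhi hL
    have := H3 (a β / u β) hmem β ((le_max_left _ _).trans hβ) L ((le_max_left _ _).trans hΛ)
    rwa [heq] at this

/-- Ratio convergence to `c₀ > 0` puts `a/u` eventually in the window `[c₀/2, 2c₀]`. [folklore] -/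
theorem eventually_window_of_tendsto_div {a u : ℝ → ℝ} {c₀ : ℝ} (hc₀ : 0 < c₀)
    (hau : Tendsto (fun β => a β / u β) atTop (𝓝 c₀)) :
    ∀ᶠ β in atTop, c₀ / 2 ≤ a β / u β ∧ a β / u β ≤ 2 * c₀ := by
  have h : ∀ᶠ β in atTop, a β / u β ∈ Set.Ioo (c₀ / 2) (2 * c₀) :=
    hau.eventually (Ioo_mem_nhds (by linarith) (by linarith))
  filter_upwards [h] with β hβ
  exact ⟨hβ.1.le, hβ.2.le⟩

/-- **The floors stub from a scale-window engine** (skeleton shape, `SU(2)` Borel): ONE lattice representation of `SU(2)`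
with window floors (same witnesses for all smearing scales `a β / s`, `s ∈ [s₁, s₂]`, `0 < s₁`) at an engine unit `a`
two-loop-commensurate with the unit of record UP TO BOUNDED FACTORS (`s₁ ≤ a β / uRec β ≤ s₂` eventually) ⇒ the
conclusion of the registered `stub_floors` verbatim.  No ceilings, no `UV`. [folklore] -/
theorem stubFloors_of_windowEngine
    (heng : letI : MeasurableSpace (Matrix.specialUnitaryGroup (Fin 2) ℂ) := borel _
      haveI : BorelSpace (Matrix.specialUnitaryGroup (Fin 2) ℂ) := ⟨rfl⟩
      ∃ (r : LatticeRep (Matrix.specialUnitaryGroup (Fin 2) ℂ)) (a : ℝ → ℝ) (s₁ s₂ : ℝ), 0 < s₁ ∧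
        (∀ᶠ β in atTop, s₁ ≤ a β / Transport.uRec β ∧ a β / Transport.uRec β ≤ s₂) ∧
        (∃ (v : 𝓢(EuclideanSpace ℝ (Fin 4), ℝ)) (ε β₅ Λ₅ : ℝ),
          tsupport (v : EuclideanSpace ℝ (Fin 4) → ℝ) ⊆ {y : EuclideanSpace ℝ (Fin 4) | 0 < y 0} ∧ 0 < ε ∧
          ∀ s ∈ Set.Icc s₁ s₂, ∀ β : ℝ, β₅ ≤ β → ∀ L : ℕ, Λ₅ ≤ a β * L →
            ε ≤ Q2 (Matrix.specialUnitaryGroup (Fin 2) ℂ) r β L (a β / s) (thetaTest 4 v) v) ∧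
        (∃ (f g h : 𝓢(EuclideanSpace ℝ (Fin 4), ℝ)) (ε β₅ Λ₅ : ℝ),
          Disjoint (tsupport (f : EuclideanSpace ℝ (Fin 4) → ℝ)) (tsupport (g : EuclideanSpace ℝ (Fin 4) → ℝ)) ∧
          Disjoint (tsupport (g : EuclideanSpace ℝ (Fin 4) → ℝ)) (tsupport (h : EuclideanSpace ℝ (Fin 4) → ℝ)) ∧
          Disjoint (tsupport (f : EuclideanSpace ℝ (Fin 4) → ℝ)) (tsupport (h : EuclideanSpace ℝ (Fin 4) → ℝ)) ∧ 0 < ε ∧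
          ∀ s ∈ Set.Icc s₁ s₂, ∀ β : ℝ, β₅ ≤ β → ∀ L : ℕ, Λ₅ ≤ a β * L →
            ε ≤ |Q3 (Matrix.specialUnitaryGroup (Fin 2) ℂ) r β L (a β / s) f g h|)) :
    letI : MeasurableSpace (Matrix.specialUnitaryGroup (Fin 2) ℂ) := borel _
    haveI : BorelSpace (Matrix.specialUnitaryGroup (Fin 2) ℂ) := ⟨rfl⟩
    ∃ r : LatticeRep (Matrix.specialUnitaryGroup (Fin 2) ℂ),
      LowerBounds (Matrix.specialUnitaryGroup (Fin 2) ℂ) r Transport.uRec := by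
  letI : MeasurableSpace (Matrix.specialUnitaryGroup (Fin 2) ℂ) := borel _
  haveI : BorelSpace (Matrix.specialUnitaryGroup (Fin 2) ℂ) := ⟨rfl⟩
  obtain ⟨r, a, s₁, s₂, hs₁, hwin, h2, h3⟩ := heng
  exact ⟨r, lowerBounds_of_window r hs₁ (fun β => Real.exp_pos _) hwin h2 h3⟩

end Summit.QuantumFields.YangMills.Cruxes.UVSeamRec.WindowTransfer

end
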